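import Literature.AlgebraicGeometry.CossartJannsenSaito2020.KeyTheorems
import Literature.AlgebraicGeometry.Resolution.FiniteBirationalNormal
import Literature.AlgebraicGeometry.Resolution.AlterationsNormalFormStrictTransform
import Literature.AlgebraicGeometry.Resolution.NormalCrossingsLocal
import Literature.AlgebraicGeometry.Morphisms.SubschemeIntegral
import Mathlib.AlgebraicGeometry.ZariskisMainTheorem
import Mathlib.AlgebraicGeometry.Morphisms.ClosedImmersion
import Mathlib.AlgebraicGeometry.ResidueField
import Literature.AlgebraicGeometry.Resolution.RegularLocalRingsNormal
import HarnessLib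

/-!
# [OURS · L1 W4.2] RECOGNITION-GEOMETRY (R3): «`π_q : C_q ⥲ C_{q−1}`» — a proper map that is BIJECTIVE with TRIVIAL
# RESIDUE EXTENSIONS from a closed irreducible subset onto a NORMAL closed irreducible subset induces an isomorphism of the
# reduced closed subschemes (`InducesIsoOn`) (crux chain w42, line `w_ladder`; `--supports stmt-…-19249`, helper)

OURS (cell res-hironaka, slot W4.2, seat res-L1-w42-stub-2 gen 3); NOT statements of H. Hironaka's manuscript [Hironaka2017]
nor of [CossartJannsenSaito2020]. AI-drafted, weaker than expert review. Sorry-free PROOF file (no new definition), FACT-FREE.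
Field (iv) of CJS Def. 6.38 / (iii) of Def. 6.34 for CURVE centres (lead-1 `RECOGNITION-CUT.md` (R3), p. 104 top: «`k(η_{q−1}) =
k(η_q)`; `C_q ≅ C_{q−1}`»): the kernel is the tree's «integral birational onto normal ⇒ iso» (`…Resolution.FiniteBirationalNormal`,
de Jong 1996 4.16), fed by Zariski's main theorem in Mathlib (`IsFinite.of_isProper_of_locallyQuasiFinite`).

* `Helpers.isIso_residueFieldMap_of_surjectiveOnStalks` — closed immersions have trivial residue extensions.
* `Helpers.isIso_stalkMap_genericPoint_of_isIso_residueFieldMap` — for a SURJECTIVE morphism of integral schemes, a trivial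
  residue extension at the generic point is an isomorphism of function fields.
* `Helpers.isIso_of_isProper_of_injective_of_isIso_residueFieldMap` — **a proper, bijective morphism of integral schemes with
  trivial residue extension at the generic point onto a NORMAL scheme is an isomorphism.**
* `Helpers.isIrreducible_of_bijOn_of_isClosedMap` — irreducibility pulls back along a closed bijection.
* `Helpers.inducesIsoOn_of_bijOn_of_isIso_residueFieldMap` (and `…'`, irreducibility of `C'` discharged) — **`InducesIsoOn π C' C`** for `π` proper, `C', C` closed
  irreducible, `π` bijective `C' → C` with `IsIso (π.residueFieldMap y')` on `C'`, and the reduced subscheme on `C` normal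
  (e.g. `C ≅ ℙ¹_k`, or any regular curve).

* APPENDED (gen 4): `Helpers.inducesIsoOn_of_bijOn_of_isIso_residueFieldMap_generic` — the same with the residue hypothesis
  required ONLY AT THE GENERIC POINT of `C'` (all the proof uses: birationality); `Helpers.isIntegrallyClosed_stalk_of_isRegular` —
  the `hnorm` feed for a REGULAR target (regular local rings are normal, Matsumura Thm. 19.4, tree `isIntegrallyClosed_of_isRegularLocalRing`).

## References

* V. Cossart, U. Jannsen, S. Saito, LNM 2270 (2020): Def. 6.34 (iii), Def. 6.38 (iv), p. 104. [CossartJannsenSaito2020]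
* A. J. de Jong, Publ. Math. IHÉS 83 (1996), 4.16. [DeJong1996]
* H. Matsumura, *Commutative Ring Theory* (1987), Thm. 19.4. [Matsumura1987]
-/

noncomputable section

-- namespace `…Corridor3.Helpers` re-enters `…Corridor3`
set_option linter.dupNamespace false

open CategoryTheory CategoryTheory.Limits AlgebraicGeometry TopologicalSpace IsLocalRing
open Literature.AlgebraicGeometry.Resolution
open Scheme.IdealSheafData

universe u

open Literature.AlgebraicGeometry.CossartJannsenSaito2020

namespace Summit.ResolutionOfSingularities.ResolutionOfSingularities.Theorems.SigmaMaxModificationsCorridor3.Helpers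

/-! ## Residue fields and stalks -/

/-- A morphism surjective on stalks (e.g. a closed immersion) has trivial residue extensions. [folklore] -/
theorem isIso_residueFieldMap_of_surjectiveOnStalks {X Y : Scheme.{u}} (f : X ⟶ Y) [SurjectiveOnStalks f] (x : X) :
    IsIso (f.residueFieldMap x) := by
  have hsurj : Function.Surjective (f.residueFieldMap x) := by
    intro a
    obtain ⟨b, rfl⟩ := X.residue_surjective x a
    obtain ⟨c, rfl⟩ := f.stalkMap_surjective x b
    refine ⟨Y.residue (f.base x) c, ?_⟩
    change (Y.residue (f.base x) ≫ f.residueFieldMap x) c = (f.stalkMap x ≫ X.residue x) c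
    rw [Scheme.residue_residueFieldMap]
  exact (ConcreteCategory.isIso_iff_bijective _).mpr ⟨(f.residueFieldMap x).hom.injective, hsurj⟩

/-- A SURJECTIVE morphism of integral schemes sends the generic point to the generic point. [folklore] -/
theorem apply_genericPoint_of_surjective {X Y : Scheme.{u}} [IsIntegral X] [IsIntegral Y] (f : X ⟶ Y)
    (hf : Function.Surjective f.base) : f.base (genericPoint X) = genericPoint Y := by
  apply (IsGenericPoint.eq _ (genericPoint_spec Y))
  rw [isGenericPoint_iff_specializes]
  intro y
  simp only [Set.mem_univ, iff_true]
  obtain ⟨x, rfl⟩ := hf y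
  exact ((genericPoint_spec X).specializes (by simp)).map f.continuous

/-- For a SURJECTIVE morphism of integral schemes, a trivial residue extension at the generic point is an isomorphism of the
stalks there (both are the function fields). [folklore] -/
theorem isIso_stalkMap_genericPoint_of_isIso_residueFieldMap {X Y : Scheme.{u}} [IsIntegral X] [IsIntegral Y] (f : X ⟶ Y)
    (hf : Function.Surjective f.base) [IsIso (f.residueFieldMap (genericPoint X))] :
    IsIso (f.stalkMap (genericPoint X)) := by
  have hξ : f.base (genericPoint X) = genericPoint Y := apply_genericPoint_of_surjective f hf
  -- both stalks are fields
  have hX : IsField (X.presheaf.stalk (genericPoint X)) := Field.toIsField (R := X.functionField)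
  have hY : IsField (Y.presheaf.stalk (f.base (genericPoint X))) := by
    rw [hξ]; exact Field.toIsField (R := Y.functionField)
  set ξ := genericPoint X
  -- the residue maps of fields are bijective
  have hresX : Function.Bijective (X.residue ξ) := by
    refine ⟨?_, X.residue_surjective ξ⟩
    change Function.Injective (IsLocalRing.residue (X.presheaf.stalk ξ))
    rw [injective_iff_map_eq_zero]
    intro a ha
    rw [IsLocalRing.residue_eq_zero_iff, (IsLocalRing.isField_iff_maximalIdeal_eq).mp hX] at ha
    exact ha
  have hresY : Function.Bijective (Y.residue (f.base ξ)) := by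
    refine ⟨?_, Y.residue_surjective _⟩
    change Function.Injective (IsLocalRing.residue (Y.presheaf.stalk (f.base ξ)))
    rw [injective_iff_map_eq_zero]
    intro a ha
    rw [IsLocalRing.residue_eq_zero_iff, (IsLocalRing.isField_iff_maximalIdeal_eq).mp hY] at ha
    exact ha
  have hr : Function.Bijective (f.residueFieldMap ξ) := ConcreteCategory.bijective_of_isIso _
  -- the square `residue ≫ residueFieldMap = stalkMap ≫ residue`
  have hsq : ∀ c, (f.residueFieldMap ξ) (Y.residue (f.base ξ) c) = X.residue ξ (f.stalkMap ξ c) := by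
    intro c
    change (Y.residue (f.base ξ) ≫ f.residueFieldMap ξ) c = (f.stalkMap ξ ≫ X.residue ξ) c
    rw [Scheme.residue_residueFieldMap]
  refine (ConcreteCategory.isIso_iff_bijective _).mpr ⟨fun a b hab => ?_, fun b => ?_⟩
  · apply hresY.1
    apply hr.1
    rw [hsq, hsq]
    exact congrArg _ hab
  · obtain ⟨a, ha⟩ := (hr.2.comp hresY.2) (X.residue ξ b)
    refine ⟨a, hresX.1 ?_⟩
    rw [← hsq]
    exact ha

/-! ## Proper + bijective + generically trivial residue extension onto a normal scheme ⇒ isomorphism -/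

/-- **A proper morphism of integral schemes that is injective and surjective on points, with trivial residue extension at the
generic point, onto a scheme all of whose local rings are integrally closed, is an isomorphism**: it is quasi-finite
(injective, locally of finite type), hence finite by Zariski's main theorem (Mathlib `IsFinite.of_isProper_of_locallyQuasiFinite`),
dominant, and birational on function fields; the tree's «integral birational onto normal ⇒ iso»
(`isIso_morphismRestrict_of_isIntegralHom_of_isIso_stalkMap`, de Jong 1996 4.16) concludes affine-locally.
[cite: DeJong1996, 4.16, p. 71] -/
theorem isIso_of_isProper_of_injective_of_isIso_residueFieldMap {X Y : Scheme.{u}} [IsIntegral X] [IsIntegral Y] (f : X ⟶ Y)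
    [IsProper f] (hinj : Function.Injective f.base) (hsurj : Function.Surjective f.base)
    [IsIso (f.residueFieldMap (genericPoint X))] (hY : ∀ y : Y, IsIntegrallyClosed (Y.presheaf.stalk y)) : IsIso f := by
  haveI : LocallyQuasiFinite f := LocallyQuasiFinite.of_injective hinj
  haveI : IsFinite f := IsFinite.of_isProper_of_locallyQuasiFinite f
  haveI : IsIntegralHom f := ((IsFinite.iff_isIntegralHom_and_locallyOfFiniteType f).mp inferInstance).1
  haveI : IsDominant f := ⟨hsurj.denseRange⟩
  have hstalk : IsIso (f.stalkMap (genericPoint X)) := isIso_stalkMap_genericPoint_of_isIso_residueFieldMap f hsurj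
  have key : MorphismProperty.isomorphisms Scheme f := by
    refine (IsZariskiLocalAtTarget.iff_of_iSup_eq_top
      (P := MorphismProperty.isomorphisms Scheme) _ (iSup_nonempty_affineOpens_eq_top Y)).mpr ?_
    rintro ⟨V, hVne⟩
    show IsIso (f ∣_ (V : Y.Opens))
    haveI := hVne
    exact isIso_morphismRestrict_of_isIntegralHom_of_isIso_stalkMap f hY hstalk V
  exact key

/-! ## Irreducibility pulls back along a closed bijection -/

/-- A closed subset mapped BIJECTIVELY onto an irreducible set by a CLOSED map is irreducible. [folklore] -/
theorem isIrreducible_of_bijOn_of_isClosedMap {X Y : Type*} [TopologicalSpace X] [TopologicalSpace Y] {f : X → Y}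
    (hcl : IsClosedMap f) {S' : Set X} {S : Set Y} (hS' : IsClosed S') (hbij : Set.BijOn f S' S)
    (hirr : IsIrreducible S) : IsIrreducible S' := by
  refine ⟨?_, ?_⟩
  · obtain ⟨y, hy⟩ := hirr.nonempty
    obtain ⟨x, hx, -⟩ := hbij.surjOn hy
    exact ⟨x, hx⟩
  · rw [isPreirreducible_iff_isClosed_union_isClosed]
    intro Z₁ Z₂ hZ₁ hZ₂ hsub
    have h1 : IsClosed (f '' (S' ∩ Z₁)) := hcl _ (hS'.inter hZ₁)
    have h2 : IsClosed (f '' (S' ∩ Z₂)) := hcl _ (hS'.inter hZ₂)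
    have hS : S ⊆ f '' (S' ∩ Z₁) ∪ f '' (S' ∩ Z₂) := by
      intro y hy
      obtain ⟨x, hx, rfl⟩ := hbij.surjOn hy
      rcases hsub hx with h | h
      · exact Or.inl ⟨x, ⟨hx, h⟩, rfl⟩
      · exact Or.inr ⟨x, ⟨hx, h⟩, rfl⟩
    have back : ∀ {Z : Set X}, S ⊆ f '' (S' ∩ Z) → S' ⊆ Z := by
      intro Z hZ x hx
      obtain ⟨x', ⟨hx'S, hx'Z⟩, hfx⟩ := hZ (hbij.mapsTo hx)
      rwa [← hbij.injOn hx'S hx hfx]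
    rcases (isPreirreducible_iff_isClosed_union_isClosed.mp hirr.isPreirreducible) _ _ h1 h2 hS with h | h
    · exact Or.inl (back h)
    · exact Or.inr (back h)

/-! ## `InducesIsoOn` for curve (or any normal) centres -/

/-- **(R3) «`π` induces an isomorphism `C' ⥲ C`»** (`InducesIsoOn π C' C`, the typed clause (iii) of CJS Def. 6.34 / (iv) of
Def. 6.38): `π` proper; `C' ⊆ Y'`, `C ⊆ Y` closed and irreducible; `π` maps `C'` BIJECTIVELY onto `C` with TRIVIAL residue
extensions at the points of `C'` (CJS p. 104: at most one near point over each point of `C_{q−1}`, `k(η_q) = k(η_{q−1})`); and the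
reduced subscheme on `C` is NORMAL (all local rings integrally closed — e.g. `C ≅ ℙ¹_{k(x)}`, or any regular curve). Then the
reduced closed subschemes are isomorphic over `π`. Route: the composite `V(C') ↪ Y' → Y` has kernel `𝓘(C)` (reduced source,
closed image `C`), so it lifts through `V(C) ↪ Y` (Mathlib `IsClosedImmersion.lift`); the lift is proper, bijective, with trivial
residue extension at the generic point (closed immersions have trivial residue extensions), hence an isomorphism by
`isIso_of_isProper_of_injective_of_isIso_residueFieldMap`. [cite: CossartJannsenSaito2020, Def. 6.38 (iv), Def. 6.34 (iii), p. 104] -/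
theorem inducesIsoOn_of_bijOn_of_isIso_residueFieldMap {Y' Y : Scheme.{u}} (π : Y' ⟶ Y) [IsProper π]
    {C' : Set Y'} {C : Set Y} (hC' : IsClosed C') (hC : IsClosed C) (hirr' : IsIrreducible C') (hirr : IsIrreducible C)
    (hbij : Set.BijOn π.base C' C) (hres : ∀ y' ∈ C', IsIso (π.residueFieldMap y'))
    (hnorm : ∀ z : ↥(vanishingIdeal (⟨C, hC⟩ : Closeds Y)).subscheme,
      IsIntegrallyClosed ((vanishingIdeal (⟨C, hC⟩ : Closeds Y)).subscheme.presheaf.stalk z)) :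
    InducesIsoOn π C' hC' C hC := by
  -- the two reduced closed subschemes
  set I' : Y'.IdealSheafData := vanishingIdeal (⟨C', hC'⟩ : Closeds Y') with hI'
  set I : Y.IdealSheafData := vanishingIdeal (⟨C, hC⟩ : Closeds Y) with hI
  have hsupp' : (I'.support : Set Y') = C' := by rw [hI', coe_support_vanishingIdeal]; rfl
  have hsupp : (I.support : Set Y) = C := by rw [hI, coe_support_vanishingIdeal]; rfl
  have hrange' : Set.range I'.subschemeι.base = C' := by
    have h := I'.range_subschemeι
    rw [hsupp'] at h
    exact h
  have hrange : Set.range I.subschemeι.base = C := by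
    have h := I.range_subschemeι
    rw [hsupp] at h
    exact h
  haveI : IsIntegral I'.subscheme :=
    Literature.AlgebraicGeometry.Morphisms.isIntegral_subscheme I' (radical_vanishingIdeal _) (by rw [hsupp']; exact hirr')
  haveI : IsIntegral I.subscheme :=
    Literature.AlgebraicGeometry.Morphisms.isIntegral_subscheme I (radical_vanishingIdeal _) (by rw [hsupp]; exact hirr)
  -- the composite `V(C') ↪ Y' → Y` has kernel `𝓘(C)`
  set g : I'.subscheme ⟶ Y := I'.subschemeι ≫ π with hg
  have hgrange : Set.range g.base = C := by
    rw [hg, Scheme.Hom.comp_base, TopCat.coe_comp, Set.range_comp, hrange']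
    exact hbij.image_eq
  have hgker : g.ker = I := by
    rw [ker_eq_vanishingIdeal_range g (by rw [hgrange]; exact hC), hI]
    congr 1
    exact Closeds.ext hgrange
  have hle : I.subschemeι.ker ≤ g.ker := by rw [ker_subschemeι, hgker]
  -- the lift `f : V(C') → V(C)`
  set f : I'.subscheme ⟶ I.subscheme := IsClosedImmersion.lift I.subschemeι g hle with hf
  have hfac : f ≫ I.subschemeι = g := IsClosedImmersion.lift_fac _ _ _
  have hfpt : ∀ z' : I'.subscheme, I.subschemeι.base (f.base z') = π.base (I'.subschemeι.base z') := by
    intro z'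
    change (f ≫ I.subschemeι).base z' = (I'.subschemeι ≫ π).base z'
    rw [hfac]
  haveI : IsProper f := by
    haveI : IsProper (f ≫ I.subschemeι) := by rw [hfac]; infer_instance
    exact IsProper.of_comp f I.subschemeι
  -- `f` is injective and surjective on points
  have hmem' : ∀ z' : I'.subscheme, I'.subschemeι.base z' ∈ C' := fun z' => hrange' ▸ ⟨z', rfl⟩
  have hmem : ∀ z : I.subscheme, I.subschemeι.base z ∈ C := fun z => hrange ▸ ⟨z, rfl⟩
  have hinj : Function.Injective f.base := by
    intro a b hab
    have h1 : π.base (I'.subschemeι.base a) = π.base (I'.subschemeι.base b) := by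
      rw [← hfpt, ← hfpt, hab]
    exact I'.subschemeι.isClosedEmbedding.injective (hbij.injOn (hmem' a) (hmem' b) h1)
  have hsurj : Function.Surjective f.base := by
    intro z
    obtain ⟨y', hy', hy⟩ := hbij.surjOn (hmem z)
    obtain ⟨z', rfl⟩ := (show y' ∈ Set.range I'.subschemeι.base by rw [hrange']; exact hy')
    refine ⟨z', I.subschemeι.isClosedEmbedding.injective ?_⟩
    rw [hfpt, hy]
  -- trivial residue extension at the generic point
  haveI : IsIso (f.residueFieldMap (genericPoint I'.subscheme)) := by
    set ξ := genericPoint I'.subscheme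
    have h1 : IsIso ((f ≫ I.subschemeι).residueFieldMap ξ) := by
      rw [hfac, hg, Scheme.residueFieldMap_comp]
      exact @IsIso.comp_isIso _ _ _ _ _ _ _ (hres _ (hmem' ξ))
        (isIso_residueFieldMap_of_surjectiveOnStalks I'.subschemeι ξ)
    rw [Scheme.residueFieldMap_comp] at h1
    exact @IsIso.of_isIso_comp_left _ _ _ _ _ _ _
      (isIso_residueFieldMap_of_surjectiveOnStalks I.subschemeι (f.base ξ)) h1
  haveI : IsIso f := isIso_of_isProper_of_injective_of_isIso_residueFieldMap f hinj hsurj hnorm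
  exact ⟨asIso f, hfac⟩

/-- **(R3), irreducibility of `C'` discharged**: a proper map is closed, so `C'`, mapped bijectively onto the irreducible `C`, is
irreducible (`isIrreducible_of_bijOn_of_isClosedMap`). [cite: CossartJannsenSaito2020, Def. 6.38 (iv), p. 104] -/
theorem inducesIsoOn_of_bijOn_of_isIso_residueFieldMap' {Y' Y : Scheme.{u}} (π : Y' ⟶ Y) [IsProper π]
    {C' : Set Y'} {C : Set Y} (hC' : IsClosed C') (hC : IsClosed C) (hirr : IsIrreducible C)
    (hbij : Set.BijOn π.base C' C) (hres : ∀ y' ∈ C', IsIso (π.residueFieldMap y'))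
    (hnorm : ∀ z : ↥(vanishingIdeal (⟨C, hC⟩ : Closeds Y)).subscheme,
      IsIntegrallyClosed ((vanishingIdeal (⟨C, hC⟩ : Closeds Y)).subscheme.presheaf.stalk z)) :
    InducesIsoOn π C' hC' C hC :=
  inducesIsoOn_of_bijOn_of_isIso_residueFieldMap π hC' hC
    (isIrreducible_of_bijOn_of_isClosedMap π.isClosedMap hC' hbij hirr) hirr hbij hres hnorm

/-! ## Appended 2026-08-27 (gen 4): the residue hypothesis at the GENERIC point only; the `hnorm` feed from regularity -/

/-- **(R3′)** — `inducesIsoOn_of_bijOn_of_isIso_residueFieldMap` (p516852) with the residue-field hypothesis required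
ONLY AT THE GENERIC POINT of `C'` (that is all its proof uses: birationality). [cite: CossartJannsenSaito2020, Def. 6.38 (iv), p. 104] -/
theorem inducesIsoOn_of_bijOn_of_isIso_residueFieldMap_generic {Y' Y : Scheme.{u}} (π : Y' ⟶ Y) [IsProper π]
    {C' : Set Y'} {C : Set Y} (hC' : IsClosed C') (hC : IsClosed C) (hirr' : IsIrreducible C') (hirr : IsIrreducible C)
    (hbij : Set.BijOn π.base C' C) (hres : ∀ y' ∈ C', IsGenericPoint y' C' → IsIso (π.residueFieldMap y'))
    (hnorm : ∀ z : ↥(vanishingIdeal (⟨C, hC⟩ : Closeds Y)).subscheme,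
      IsIntegrallyClosed ((vanishingIdeal (⟨C, hC⟩ : Closeds Y)).subscheme.presheaf.stalk z)) :
    InducesIsoOn π C' hC' C hC := by
  set I' : Y'.IdealSheafData := vanishingIdeal (⟨C', hC'⟩ : Closeds Y') with hI'
  set I : Y.IdealSheafData := vanishingIdeal (⟨C, hC⟩ : Closeds Y) with hI
  have hsupp' : (I'.support : Set Y') = C' := by rw [hI', Scheme.IdealSheafData.coe_support_vanishingIdeal]; rfl
  have hsupp : (I.support : Set Y) = C := by rw [hI, Scheme.IdealSheafData.coe_support_vanishingIdeal]; rfl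
  have hrange' : Set.range I'.subschemeι.base = C' := by
    have h := I'.range_subschemeι
    rw [hsupp'] at h
    exact h
  have hrange : Set.range I.subschemeι.base = C := by
    have h := I.range_subschemeι
    rw [hsupp] at h
    exact h
  haveI : IsIntegral I'.subscheme :=
    Literature.AlgebraicGeometry.Morphisms.isIntegral_subscheme I' (radical_vanishingIdeal _) (by rw [hsupp']; exact hirr')
  haveI : IsIntegral I.subscheme :=
    Literature.AlgebraicGeometry.Morphisms.isIntegral_subscheme I (radical_vanishingIdeal _) (by rw [hsupp]; exact hirr)
  set g : I'.subscheme ⟶ Y := I'.subschemeι ≫ π with hg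
  have hgrange : Set.range g.base = C := by
    rw [hg, Scheme.Hom.comp_base, TopCat.coe_comp, Set.range_comp, hrange']
    exact hbij.image_eq
  have hgker : g.ker = I := by
    rw [ker_eq_vanishingIdeal_range g (by rw [hgrange]; exact hC), hI]
    congr 1
    exact Closeds.ext hgrange
  have hle : I.subschemeι.ker ≤ g.ker := by rw [ker_subschemeι, hgker]
  set f : I'.subscheme ⟶ I.subscheme := IsClosedImmersion.lift I.subschemeι g hle with hf
  have hfac : f ≫ I.subschemeι = g := IsClosedImmersion.lift_fac _ _ _
  have hfpt : ∀ z' : I'.subscheme, I.subschemeι.base (f.base z') = π.base (I'.subschemeι.base z') := by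
    intro z'
    change (f ≫ I.subschemeι).base z' = (I'.subschemeι ≫ π).base z'
    rw [hfac]
  haveI : IsProper f := by
    haveI : IsProper (f ≫ I.subschemeι) := by rw [hfac]; infer_instance
    exact IsProper.of_comp f I.subschemeι
  have hmem' : ∀ z' : I'.subscheme, I'.subschemeι.base z' ∈ C' := fun z' => hrange' ▸ ⟨z', rfl⟩
  have hmem : ∀ z : I.subscheme, I.subschemeι.base z ∈ C := fun z => hrange ▸ ⟨z, rfl⟩
  have hinj : Function.Injective f.base := by
    intro a b hab
    have h1 : π.base (I'.subschemeι.base a) = π.base (I'.subschemeι.base b) := by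
      rw [← hfpt, ← hfpt, hab]
    exact I'.subschemeι.isClosedEmbedding.injective (hbij.injOn (hmem' a) (hmem' b) h1)
  have hsurj : Function.Surjective f.base := by
    intro z
    obtain ⟨y', hy', hy⟩ := hbij.surjOn (hmem z)
    obtain ⟨z', rfl⟩ := (show y' ∈ Set.range I'.subschemeι.base by rw [hrange']; exact hy')
    refine ⟨z', I.subschemeι.isClosedEmbedding.injective ?_⟩
    rw [hfpt, hy]
  -- the generic point of `V(C')` maps to a generic point of `C'`
  haveI : IsIso (f.residueFieldMap (genericPoint I'.subscheme)) := by
    set ξ := genericPoint I'.subscheme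
    have hξ : IsGenericPoint (I'.subschemeι.base ξ) C' := by
      have h := (genericPoint_spec I'.subscheme).image I'.subschemeι.continuous
      rwa [Set.image_univ, hrange', hC'.closure_eq] at h
    have h1 : IsIso ((f ≫ I.subschemeι).residueFieldMap ξ) := by
      rw [hfac, hg, Scheme.residueFieldMap_comp]
      exact @IsIso.comp_isIso _ _ _ _ _ _ _ (hres _ (hmem' ξ) hξ)
        (isIso_residueFieldMap_of_surjectiveOnStalks I'.subschemeι ξ)
    rw [Scheme.residueFieldMap_comp] at h1
    exact @IsIso.of_isIso_comp_left _ _ _ _ _ _ _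
      (isIso_residueFieldMap_of_surjectiveOnStalks I.subschemeι (f.base ξ)) h1
  haveI : IsIso f := isIso_of_isProper_of_injective_of_isIso_residueFieldMap f hinj hsurj hnorm
  exact ⟨asIso f, hfac⟩

/-- The reduced closed subscheme on a closed subset whose reduced structure is REGULAR is normal: all its local rings are
integrally closed (regular local rings are normal, Matsumura Thm. 19.4) — the `hnorm` feed of (R3). [cite: Matsumura1987, Thm. 19.4] -/
theorem isIntegrallyClosed_stalk_of_isRegular {Z : Scheme.{u}} (hZ : Scheme.IsRegular Z) (z : Z) :
    IsIntegrallyClosed (Z.presheaf.stalk z) := by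
  haveI := hZ z
  exact isIntegrallyClosed_of_isRegularLocalRing _

end Summit.ResolutionOfSingularities.ResolutionOfSingularities.Theorems.SigmaMaxModificationsCorridor3.Helpers

end
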